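import Summits.BirchSwinnertonDyer.Rank1Residual.ManinAdditive.KatoCurvePlusDefect
import Literature.NumberTheory.EllipticCurves.BSDHeegnerPoints
import Literature.NumberTheory.EllipticCurves.SkinnerUrban2014.PAdicUnitPeriodRatioAnyPrimeProofs
import Literature.NumberTheory.EllipticCurves.ModularCurveManinConstantProofs
import Literature.NumberTheory.EllipticCurves.HeegnerPointsConjugationClassProofs
import Literature.NumberTheory.EllipticCurves.ModularCurveManinSemistableBridgeProofs
import Literature.NumberTheory.EllipticCurves.IsogenyDualInseparableProofs
import HarnessLib
import HarnessLib.Audit.Tags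

/-!
# E-es-63 `KatoCurvePeriodDvdOfNoPlusDefect` IS A THEOREM — inputs (A), (B) and the lattice core, PROVED
# (cell `bsd-f2-manin`, Euler-system lens `bsd-f2-manin-es` gen 17 §2, VERBATIM; typing ask T-es-21 (ii))

Sorry-free proofs, copied VERBATIM (names, statements, tactic scripts) from HOME/es/Sketch-es-g17.lean
93557c1a115c1402 §2 (farm rc 0 · 0 sorries · axioms standard; refuter-1 §R60 (b): kernel re-checked, no hidden
hypothesis beyond lattice-optimality), re-keyed to the leaf `KatoCurvePlusDefect.lean` and the Literature vocabulary
`IsSymbolClosureCurve`.  Contents: `periodLattice_le_symbolClosure` (`Λ_f ⊆ 𝓛̄_f`), `conj_mem_symbolClosure`,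
`conj_mem_periodLattice'`, `realPeriodRat_pos`, the LATTICE CORE `periodDividesAt_of_inputs`, input (A)
`neronLatticeRePartAttained_holds` (bare Néron pair lemmas `neronPair_g₂/g₃`, `isReal_neronPair`, `discr_neronPair`,
`realPeriodRat_eq_numRealComponents_mul_neronPair`), input (B) `symbolClosureScalarIsMultiple_holds`
(`int_of_real_mul_mem_lattice_self`, Manin–Drinfeld closure induction `exists_nat_mul_mem_periodLattice`), and
**`katoCurvePeriodDvdOfNoPlusDefect_holds : KatoCurvePeriodDvdOfNoPlusDefect`**; plus
`cuspidalReducedPlusDefectPrimeTo_of_plusDefect` (`pd_p = 0` is the `s = 0` case).  Tree inputs: isogeny multiplier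
`exists_rat_mulLeft_lattice_le_of_isogeny`, Manin–Drinfeld `exists_nsmul_modularSymbol_mem_periodLattice_of_isNewform0`,
Néron integrality `integral_neronScaling_of_isGloballyMinimal_holds`, `IsNewform0.plusPeriod_pos_holds`,
`realPeriods_eq_zmultiples_of_plusPeriod_pos`, `D.realPeriodRat_eq_abs_mul_plusPeriod_of_latticeEq`.  Elementary
lattice bookkeeping; beyond-print theorem: no; BSD is not proved by this; Manin's conjecture is not proved by this.
-/

set_option autoImplicit false

noncomputable section

open scoped Classical MatrixGroups ModularForm ComplexConjugate

open CongruenceSubgroup Complex WeierstrassCurve Literature.NumberTheory.EllipticCurves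
  Literature.NumberTheory.EllipticCurves.ModularForms

namespace Summit.BirchSwinnertonDyer.Rank1Residual.ManinAdditive.KatoCurve

open Summit.BirchSwinnertonDyer.Rank1Residual.ManinAdditive.CuspidalKummer
  Summit.BirchSwinnertonDyer.Rank1Residual.ManinAdditive.CuspidalKummerThree

variable {W : WeierstrassCurve ℚ} {N : ℕ} [NeZero N]

omit [NeZero N] in
/-- `Λ_f ⊆ L̄_f`: every `{∞, γ∞}_f` is a modular symbol `{∞, a/c}_f` (or `0`). -/
theorem periodLattice_le_symbolClosure (f : CuspForm (Gamma0 N) 2) :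
    periodLattice f ≤ AddSubgroup.closure (Set.range (modularSymbol f)) := by
  rw [periodLattice, AddSubgroup.closure_le]
  rintro _ ⟨γ, rfl⟩
  by_cases h : (γ : SL(2, ℤ)) 1 0 = 0
  · simp only [cuspSymbol, h, ↓reduceIte, SetLike.mem_coe]
    exact zero_mem _
  · simp only [cuspSymbol, h, ↓reduceIte, SetLike.mem_coe]
    exact AddSubgroup.subset_closure ⟨_, rfl⟩

/-- The symbol lattice `L̄_f` of the newform of a curve over `ℚ` is conjugation-stable (`conj {∞,r} = {∞,−r}`). -/
theorem conj_mem_symbolClosure (D : ModularParametrizationData W N) {x : ℂ}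
    (hx : x ∈ AddSubgroup.closure (Set.range (modularSymbol D.f))) :
    conj x ∈ AddSubgroup.closure (Set.range (modularSymbol D.f)) := by
  have him : ∀ n, (cuspCoeff D.f n).im = 0 := fun n ↦
    Complex.conj_eq_iff_im.mp (conj_cuspCoeff_of_isNewformOf D.isNewformOf n)
  induction hx using AddSubgroup.closure_induction with
  | mem y hy =>
    obtain ⟨r, rfl⟩ := hy
    rw [← modularSymbol_neg_eq_conj_holds D.f him r]
    exact AddSubgroup.subset_closure ⟨-r, rfl⟩
  | zero => simp
  | add y z _ _ hy hz => simpa using add_mem hy hz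
  | neg y _ hy => simpa using neg_mem hy

/-- `Λ_f` of the newform of a curve over `ℚ` is conjugation-stable (tree fact `conj_mem_periodLattice_holds`). -/
theorem conj_mem_periodLattice' (D : ModularParametrizationData W N) {y : ℂ} (hy : y ∈ periodLattice D.f) :
    conj y ∈ periodLattice D.f :=
  conj_mem_periodLattice_holds (f := D.f) D.isNewformOf.1 D.isNewformOf.coeffField_eq_bot hy

/-- `Ω(V) > 0` for an elliptic curve over `ℚ` (tree: `realPeriod_pos'`). -/
theorem realPeriodRat_pos (V : WeierstrassCurve ℚ) [V.IsElliptic] : 0 < V.realPeriodRat := by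
  haveI : (V.baseChange ℝ).IsElliptic := by rw [WeierstrassCurve.baseChange]; infer_instance
  exact (V.baseChange ℝ).realPeriod_pos'

/-- THE LATTICE CORE of E-es-63 (sorry-free): inputs (A) at `VK`, (B), lattice-optimality and `pd_p = 0` give
`Ω(W) ∣_p Ω(VK)`. -/
theorem periodDividesAt_of_inputs (p : ℕ) (W : WeierstrassCurve ℚ) [W.IsElliptic] [W.IsGloballyMinimal]
    (D : ModularParametrizationData W N)
    (hopt : ∀ z ∈ D.L.lattice, ∃ w ∈ periodLattice D.f, z = D.c * w)
    (hpd : CuspidalPlusDefectPrimeTo p D)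
    (VK : WeierstrassCurve ℚ) [VK.IsElliptic] (L : PeriodPair) (u : ℝ)
    (hL : ∀ z : ℂ, z ∈ L.lattice ↔ ∃ w ∈ AddSubgroup.closure (Set.range (modularSymbol D.f)), z = (u : ℂ) * w)
    (hA : ∃ z ∈ L.lattice, z.re = VK.realPeriodRat / 2)
    (hB : ∃ k : ℕ, 0 < k ∧ u = (k : ℝ) * |(D.c : ℝ)|) :
    PeriodDividesAt p VK W := by
  have hplus : 0 < plusPeriod D.f :=
    IsNewform0.plusPeriod_pos_holds D.isNewformOf.1 D.isNewformOf.coeffField_eq_bot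
  have hre : realPeriods D.f = AddSubgroup.zmultiples (plusPeriod D.f / 2) :=
    realPeriods_eq_zmultiples_of_plusPeriod_pos D.f hplus
  have hΩW : W.realPeriodRat = |(D.c : ℝ)| * plusPeriod D.f :=
    D.realPeriodRat_eq_abs_mul_plusPeriod_of_latticeEq hopt
  have hΩWpos : 0 < W.realPeriodRat := realPeriodRat_pos W
  have hΩKpos : 0 < VK.realPeriodRat := realPeriodRat_pos VK
  obtain ⟨z₀, hz₀, hz₀re⟩ := hA
  obtain ⟨x₀, hx₀, rfl⟩ := (hL z₀).mp hz₀
  obtain ⟨n, hn, y, hy, hxy⟩ := hpd x₀ hx₀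
  obtain ⟨k, hk, hu⟩ := hB
  -- `re y = j Ω⁺/2`
  have hyre : y.re ∈ realPeriods D.f := by
    rw [realPeriods, AddSubgroup.mem_map]; exact ⟨y, hy, rfl⟩
  rw [hre, AddSubgroup.mem_zmultiples_iff] at hyre
  obtain ⟨j, hj⟩ := hyre
  -- real parts of `n (x₀ + conj x₀) = y + conj y`: `2 n re x₀ = 2 re y`
  have h1 : (n : ℝ) * x₀.re = y.re := by
    have h := congrArg Complex.re hxy
    simp only [Complex.mul_re, Complex.natCast_re, Complex.natCast_im, Complex.add_re, Complex.conj_re,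
      Complex.add_im, Complex.conj_im, zero_mul, sub_zero] at h
    linarith
  -- `Ω(VK)/2 = u re x₀`
  have h2 : VK.realPeriodRat / 2 = u * x₀.re := by
    rw [← hz₀re, Complex.mul_re, Complex.ofReal_re, Complex.ofReal_im, zero_mul, sub_zero]
  -- assemble: `n Ω(VK) = 2 n u re x₀ = 2 u re y = u j Ω⁺ = k |c| j Ω⁺ = k j Ω(W)`
  have hVK : VK.realPeriodRat = 2 * u * x₀.re := by linarith
  have hj' : y.re = (j : ℝ) * (plusPeriod D.f / 2) := by rw [← hj, zsmul_eq_mul]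
  have h3 : (n : ℝ) * VK.realPeriodRat = ((k : ℝ) * j) * W.realPeriodRat := by
    calc (n : ℝ) * VK.realPeriodRat = 2 * u * ((n : ℝ) * x₀.re) := by rw [hVK]; ring
      _ = 2 * u * y.re := by rw [h1]
      _ = ((k : ℝ) * j) * W.realPeriodRat := by rw [hj', hu, hΩW]; ring
  -- `k j > 0`, so `j` is a positive integer
  have hnpos : 0 < (n : ℝ) := by
    have : n ≠ 0 := by rintro rfl; exact hn (dvd_zero p)
    exact_mod_cast Nat.pos_of_ne_zero this
  have hkj : 0 < (k : ℝ) * j := by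
    by_contra hle
    push Not at hle
    nlinarith [mul_pos hnpos hΩKpos, hΩWpos, h3, hle]
  have hk' : (0 : ℝ) < k := by exact_mod_cast hk
  have hjpos : (0 : ℤ) < j := by
    have : (0 : ℝ) < j := by
      by_contra hle
      push Not at hle
      nlinarith [hkj, hk', hle]
    exact_mod_cast this
  obtain ⟨j', rfl⟩ := Int.eq_ofNat_of_zero_le hjpos.le
  have hj'pos : 0 < j' := by exact_mod_cast hjpos
  refine ⟨k * j', n, Nat.mul_pos hk hj'pos, hn, ?_⟩
  rw [h3]; push_cast; ring

/-! ### Input (A) is a theorem: the tree's `D.L`-lemmas for a bare Néron period pair -/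

section BarePair

variable {V : WeierstrassCurve ℚ} {L : PeriodPair} (hL : IsNeronLatticeOf (V.baseChange ℂ) L)
include hL

omit [NeZero N] in
/-- `g₂(L) = c₄(V)/12` (real, cast to `ℂ`). -/
theorem neronPair_g₂ : L.g₂ = ((((V.c₄ : ℚ) : ℝ) / 12 : ℝ) : ℂ) := by
  rw [hL.1, WeierstrassCurve.baseChange, WeierstrassCurve.map_c₄, eq_ratCast]
  push_cast
  ring

omit [NeZero N] in
/-- `g₃(L) = c₆(V)/216` (real, cast to `ℂ`). -/
theorem neronPair_g₃ : L.g₃ = ((((V.c₆ : ℚ) : ℝ) / 216 : ℝ) : ℂ) := by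
  rw [hL.2, WeierstrassCurve.baseChange, WeierstrassCurve.map_c₆, eq_ratCast]
  push_cast
  ring

omit [NeZero N] in
/-- A Néron period pair of a curve over `ℚ` is a real lattice. -/
theorem isReal_neronPair : L.IsReal :=
  PeriodPair.isReal_of_g₂_g₃_real PeriodPair.uniformization_unique_holds
    (by rw [neronPair_g₂ hL, Complex.ofReal_im]) (by rw [neronPair_g₃ hL, Complex.ofReal_im])

omit [NeZero N] in
/-- `disc(L) = Δ(V)`. -/
theorem discr_neronPair : L.g₂.re ^ 3 - 27 * L.g₃.re ^ 2 = (V.baseChange ℝ).Δ := by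
  rw [neronPair_g₂ hL, neronPair_g₃ hL, Complex.ofReal_re, Complex.ofReal_re,
    ← ModularParametrizationData.baseChange_real_c₄, ← ModularParametrizationData.baseChange_real_c₆,
    show ((V.baseChange ℝ).c₄ / 12) ^ 3 - 27 * ((V.baseChange ℝ).c₆ / 216) ^ 2 =
      ((V.baseChange ℝ).c₄ ^ 3 - (V.baseChange ℝ).c₆ ^ 2) / 1728 by ring,
    ← (V.baseChange ℝ).c_relation]
  ring

omit [NeZero N] in
/-- `Ω(V) = #π₀(V(ℝ)) · Ω₀(L)` for a bare Néron pair (tree: `D.realPeriodRat_eq_numRealComponents_mul`). -/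
theorem realPeriodRat_eq_numRealComponents_mul_neronPair [V.IsElliptic] :
    V.realPeriodRat = (V.baseChange ℝ).numRealComponents * L.minRealPeriod := by
  haveI : (V.baseChange ℝ).IsElliptic := by
    rw [WeierstrassCurve.baseChange]; infer_instance
  obtain ⟨L', h₂', h₃', hΩ⟩ := (V.baseChange ℝ).exists_periodPair_realPeriod_eq_holds
  have hlat : L.lattice = L'.lattice :=
    PeriodPair.uniformization_unique_holds _ _
      (by rw [h₂', neronPair_g₂ hL, ModularParametrizationData.baseChange_real_c₄])
      (by rw [h₃', neronPair_g₃ hL, ModularParametrizationData.baseChange_real_c₆])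
  rw [WeierstrassCurve.realPeriodRat_def, hΩ, PeriodPair.minRealPeriod_def, hlat]

end BarePair

omit [NeZero N] in
/-- **Input (A) PROVED**: `Ω(V)/2 = re z` for some `z` in any Néron period lattice of `V`
(the tree's `D.exists_mem_lattice_re_eq_realPeriodRat_div_two`, bare-pair version). -/
theorem neronLatticeRePartAttained_holds : NeronLatticeRePartAttained := by
  intro V _ L hL
  haveI : (V.baseChange ℝ).IsElliptic := by
    rw [WeierstrassCurve.baseChange]; infer_instance
  have hR : L.IsReal := isReal_neronPair hL
  rw [realPeriodRat_eq_numRealComponents_mul_neronPair hL]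
  by_cases hΔ : 0 < (V.baseChange ℝ).Δ
  · refine ⟨(L.minRealPeriod : ℂ), hR.minRealPeriod_mem_lattice, ?_⟩
    rw [(V.baseChange ℝ).numRealComponents_of_Δ_pos hΔ, Complex.ofReal_re]
    push_cast
    ring
  · have hΔ0 : (V.baseChange ℝ).Δ ≠ 0 := (V.baseChange ℝ).isUnit_Δ.ne_zero
    have hdisc : L.g₂.re ^ 3 - 27 * L.g₃.re ^ 2 ≠ 0 := by
      rw [discr_neronPair hL]; exact hΔ0
    have hmem : I * (((L.mulLeft I I_ne_zero).minRealPeriod / 2 : ℝ) : ℂ) +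
        ((L.minRealPeriod / 2 : ℝ) : ℂ) ∈ L.lattice := by
      by_contra hnot
      exact hΔ (by
        rw [← discr_neronPair hL]
        exact hR.discr_pos_of_halfPeriodI_add_notMem hdisc hnot)
    refine ⟨_, hmem, ?_⟩
    rw [(V.baseChange ℝ).numRealComponents_of_Δ_nonpos (not_lt.mp hΔ)]
    simp only [Complex.add_re, Complex.mul_re, Complex.I_re, Complex.I_im, Complex.ofReal_re,
      Complex.ofReal_im, zero_mul, one_mul, mul_zero, sub_zero, zero_add, Nat.cast_one]

/-! ### Input (B) is a theorem: isogeny multiplier + Manin–Drinfeld + Néron integrality -/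

omit [NeZero N] in
/-- A REAL self-multiplier of a period lattice is an integer (cf. the tree's `int_of_rat_mul_mem_lattice_self`). -/
theorem int_of_real_mul_mem_lattice_self (L : PeriodPair) (t : ℝ)
    (ht : ∀ z ∈ L.lattice, (t : ℂ) * z ∈ L.lattice) : ∃ k : ℤ, (k : ℝ) = t := by
  obtain ⟨m, n, hmn⟩ : ∃ m n : ℤ, (m : ℂ) * L.ω₁ + n * L.ω₂ = (t : ℂ) * L.ω₁ :=
    PeriodPair.mem_lattice.mp (ht L.ω₁ L.ω₁_mem_lattice)
  have key : (t - m) • L.ω₁ + (-(n : ℝ)) • L.ω₂ = 0 := by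
    simp only [Complex.real_smul, Complex.ofReal_sub, Complex.ofReal_intCast, Complex.ofReal_neg]
    linear_combination -hmn
  have h := LinearIndependent.pair_iff.mp L.indep (t - m) (-(n : ℝ)) key
  exact ⟨m, by linarith [h.1]⟩

/-- MANIN–DRINFELD on the symbol lattice: every element of `L̄_f` has a positive multiple in `Λ_f`
(closure induction over the tree's per-symbol theorem `exists_nsmul_modularSymbol_mem_periodLattice_of_isNewform0`). -/
theorem exists_nat_mul_mem_periodLattice (D : ModularParametrizationData W N) {x : ℂ}
    (hx : x ∈ AddSubgroup.closure (Set.range (modularSymbol D.f))) :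
    ∃ n : ℕ, 0 < n ∧ (n : ℂ) * x ∈ periodLattice D.f := by
  induction hx using AddSubgroup.closure_induction with
  | mem y hy =>
    obtain ⟨r, rfl⟩ := hy
    obtain ⟨n, hn, hmem⟩ := exists_nsmul_modularSymbol_mem_periodLattice_of_isNewform0 (f := D.f)
      D.isNewformOf.1 D.isNewformOf.coeffField_eq_bot r
    exact ⟨n, hn, by simpa [nsmul_eq_mul] using hmem⟩
  | zero => exact ⟨1, one_pos, by simp⟩
  | add y z _ _ hy hz =>
    obtain ⟨a, ha, hya⟩ := hy
    obtain ⟨b, hb, hzb⟩ := hz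
    refine ⟨a * b, Nat.mul_pos ha hb, ?_⟩
    have : ((a * b : ℕ) : ℂ) * (y + z) = (b : ℂ) * ((a : ℂ) * y) + (a : ℂ) * ((b : ℂ) * z) := by
      push_cast; ring
    rw [this]
    refine add_mem ?_ ?_
    · simpa [nsmul_eq_mul] using AddSubgroup.nsmul_mem _ hya b
    · simpa [nsmul_eq_mul] using AddSubgroup.nsmul_mem _ hzb a
  | neg y _ hy =>
    obtain ⟨a, ha, hya⟩ := hy
    exact ⟨a, ha, by simpa [mul_neg] using neg_mem hya⟩

/-- **Input (B) PROVED**: the scalar of Kato's curve is a positive integer multiple of `|c|`. -/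
theorem symbolClosureScalarIsMultiple_holds : SymbolClosureScalarIsMultiple := by
  intro W _ _ N _ D hopt VK _ _ hiso L u hNL hu hL
  obtain ⟨φ⟩ := hiso
  have hc0 : D.c ≠ 0 := D.maninConstant_ne_zero_holds
  have hcR : (D.c : ℝ) ≠ 0 := by exact_mod_cast hc0
  have hcC : (D.c : ℂ) ≠ 0 := by exact_mod_cast hc0
  have huR : u ≠ 0 := hu.ne'
  have huC : (u : ℂ) ≠ 0 := by exact_mod_cast huR
  -- (1) the rational lattice multiplier of `φ`: `q Λ_W ⊆ Λ_K`
  obtain ⟨q, hq, hle, -⟩ := exists_rat_mulLeft_lattice_le_of_isogeny W VK D.isNeronLattice hNL φ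
  have hq0 : q ≠ 0 := by rintro rfl; exact hq (by simp)
  have hqR : (q : ℝ) ≠ 0 := by exact_mod_cast hq0
  -- `t := q c / u` maps `Λ_f` into `L̄_f`
  set t : ℝ := (q : ℝ) * (D.c : ℝ) / u with ht
  have ht0 : t ≠ 0 := by rw [ht]; exact div_ne_zero (mul_ne_zero hqR hcR) huR
  have htw : ∀ w ∈ periodLattice D.f,
      (t : ℂ) * w ∈ AddSubgroup.closure (Set.range (modularSymbol D.f)) := by
    intro w hw
    have hz : (D.c : ℂ) * w ∈ D.L.lattice := D.smul_periodLattice_le w hw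
    have hqz : ((q : ℚ) : ℂ) * ((D.c : ℂ) * w) ∈ L.lattice :=
      hle (PeriodPair.mul_mem_mulLeft_lattice.mpr hz)
    obtain ⟨w', hw', hEq⟩ := (hL _).mp hqz
    have hEq' : (t : ℂ) * w = w' := by
      rw [ht]; push_cast
      rw [div_mul_eq_mul_div, div_eq_iff huC]
      linear_combination hEq
    rw [hEq']; exact hw'
  -- (2) for a Manin–Drinfeld exponent `n₁ n₂`, `n₁ n₂ t` is a self-multiplier of `Λ_W`, hence an integer
  obtain ⟨w₁, hw₁, hω₁⟩ := hopt D.L.ω₁ D.L.ω₁_mem_lattice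
  obtain ⟨w₂, hw₂, hω₂⟩ := hopt D.L.ω₂ D.L.ω₂_mem_lattice
  obtain ⟨n₁, hn₁, h₁⟩ := exists_nat_mul_mem_periodLattice D (htw w₁ hw₁)
  obtain ⟨n₂, hn₂, h₂⟩ := exists_nat_mul_mem_periodLattice D (htw w₂ hw₂)
  have e₁ : (D.c : ℂ) * ((n₁ : ℂ) * ((t : ℂ) * w₁)) ∈ D.L.lattice := D.smul_periodLattice_le _ h₁
  have e₂ : (D.c : ℂ) * ((n₂ : ℂ) * ((t : ℂ) * w₂)) ∈ D.L.lattice := D.smul_periodLattice_le _ h₂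
  have hself : ∀ z ∈ D.L.lattice, ((((n₁ * n₂ : ℕ) : ℝ) * t : ℝ) : ℂ) * z ∈ D.L.lattice := by
    intro z hz
    obtain ⟨a, b, hab⟩ := PeriodPair.mem_lattice.mp hz
    rw [← hab, hω₁, hω₂]
    have : ((((n₁ * n₂ : ℕ) : ℝ) * t : ℝ) : ℂ) * ((a : ℂ) * ((D.c : ℂ) * w₁) + (b : ℂ) * ((D.c : ℂ) * w₂)) =
        ((a * n₂ : ℤ) : ℂ) * ((D.c : ℂ) * ((n₁ : ℂ) * ((t : ℂ) * w₁))) +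
        ((b * n₁ : ℤ) : ℂ) * ((D.c : ℂ) * ((n₂ : ℂ) * ((t : ℂ) * w₂))) := by
      push_cast; ring
    rw [this]
    refine add_mem ?_ ?_
    · simpa [zsmul_eq_mul] using D.L.lattice.smul_mem (a * n₂) e₁
    · simpa [zsmul_eq_mul] using D.L.lattice.smul_mem (b * n₁) e₂
  obtain ⟨kZ, hkZ⟩ := int_of_real_mul_mem_lattice_self D.L _ hself
  have hn0 : ((n₁ * n₂ : ℕ) : ℝ) ≠ 0 := by exact_mod_cast (Nat.mul_pos hn₁ hn₂).ne'
  have hkZ0 : (kZ : ℝ) ≠ 0 := by rw [hkZ]; exact mul_ne_zero hn0 ht0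
  have hkZ0' : kZ ≠ 0 := by rintro rfl; exact hkZ0 (by simp)
  -- (3) so `u` is rational: `u = q c (n₁ n₂) / kZ`
  set u' : ℚ := q * D.c * (n₁ * n₂ : ℕ) / kZ with hu'
  have huu' : (u' : ℝ) = u := by
    rw [hu']; push_cast
    rw [div_eq_iff hkZ0, hkZ, ht]
    field_simp
    push_cast; ring
  -- (4) Néron integrality of `u / |c|`
  have hcabs : |(D.c : ℚ)| ≠ 0 := abs_ne_zero.mpr (by exact_mod_cast hc0)
  have hmul : ∀ z ∈ D.L.lattice, (((u' / |(D.c : ℚ)| : ℚ)) : ℂ) * z ∈ L.lattice := by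
    intro z hz
    obtain ⟨w, hw, rfl⟩ := hopt z hz
    rw [hL]
    rcases lt_or_gt_of_ne hc0 with hneg | hpos
    · refine ⟨-w, neg_mem (periodLattice_le_symbolClosure D.f hw), ?_⟩
      have habs : |(D.c : ℚ)| = -D.c := by exact_mod_cast abs_of_neg hneg
      rw [habs, ← huu']; push_cast
      field_simp
    · refine ⟨w, periodLattice_le_symbolClosure D.f hw, ?_⟩
      have habs : |(D.c : ℚ)| = D.c := by exact_mod_cast abs_of_pos hpos
      rw [habs, ← huu']; push_cast
      field_simp
  obtain ⟨k, hk⟩ := integral_neronScaling_of_isGloballyMinimal_holds W VK D.L L D.isNeronLattice hNL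
    (u' / |(D.c : ℚ)|) hmul
  have hkq : (k : ℚ) * |(D.c : ℚ)| = u' := by rw [hk, div_mul_cancel₀ _ hcabs]
  have hk' : (k : ℝ) * |(D.c : ℝ)| = u := by rw [← huu']; exact_mod_cast hkq
  have hkpos : 0 < k := by
    have habs : 0 < |(D.c : ℝ)| := abs_pos.mpr hcR
    have : (0 : ℝ) < k := by
      by_contra hle
      push Not at hle
      nlinarith [hk', hu, habs, hle]
    exact_mod_cast this
  obtain ⟨k', rfl⟩ := Int.eq_ofNat_of_zero_le hkpos.le
  refine ⟨k', by exact_mod_cast hkpos, ?_⟩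
  rw [← hk']; push_cast; ring

/-- **E-es-63 from (A) and (B)** (sorry-free assembly). -/
theorem katoCurvePeriodDvdOfNoPlusDefect_of_A_of_B
    (hA : NeronLatticeRePartAttained) (hB : SymbolClosureScalarIsMultiple) :
    KatoCurvePeriodDvdOfNoPlusDefect := by
  intro p W _ _ N _ D hopt hpd VK _ _ hiso hK
  obtain ⟨L, u, hNL, hu, hL⟩ := hK
  exact periodDividesAt_of_inputs p W D hopt hpd VK L u hL (hA VK L hNL) (hB W D hopt VK hiso L u hNL hu hL)

/-- **E-es-63 IS A THEOREM** (sorry-free: inputs (A) and (B) are proved above). -/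
theorem katoCurvePeriodDvdOfNoPlusDefect_holds : KatoCurvePeriodDvdOfNoPlusDefect :=
  katoCurvePeriodDvdOfNoPlusDefect_of_A_of_B neronLatticeRePartAttained_holds symbolClosureScalarIsMultiple_holds

/-- Sanity: no plus-defect (`pd_p = 0`) is the `s = 0` case of no REDUCED plus-defect. -/
theorem cuspidalReducedPlusDefectPrimeTo_of_plusDefect (p : ℕ) (D : ModularParametrizationData W N)
    (h : CuspidalPlusDefectPrimeTo p D) : CuspidalReducedPlusDefectPrimeTo p D := by
  refine ⟨0, fun y hy => ?_, fun x hx => ?_⟩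
  · simpa using periodLattice_le_symbolClosure D.f hy
  · obtain ⟨n, hn, y, hy, hxy⟩ := h x hx
    exact ⟨n, hn, y, hy, by simpa using hxy⟩

end Summit.BirchSwinnertonDyer.Rank1Residual.ManinAdditive.KatoCurve

end
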